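import Mathlib

/-!
# Alphabet reduction for the greedy shadow of a planar frame (stub C of `DissociatedUniform`)

Words `a ∈ Fintype.piFinset A` of a frame `A : Fin m → Finset (Fin 2 →₀ ℕ)` carry a planar point `∑ j, a j`
and a Khatri–Rao column `col f a ∈ ℂ^k`.  For a direction `w` the *greedy* words are those whose column is
not in the span of the columns of strictly `w`-higher words; the *shadow* is the set of words greedy for
some *generic* direction (heights separate words).  We prove: if every sub-box `B ≤ A` with `≤ k` letters
per coordinate has a shadow of size `≤ N`, then a frame with `≤ t` letters per coordinate has a shadow of
size `≤ (k*m*t+2)^4 * N` (the dissociation hypothesis of the registered signature is not needed).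

Proof.  Fix a generic `w` and a greedy word `a`.  (i) Every letter `a j` is a *greedy letter* (its letter
column is outside the span of the letter columns of strictly higher letters of `A j`: Hadamard
multiplication by the other coordinates is linear and maps higher letters to higher words).  (ii) Greedy
letters have linearly independent columns in `ℂ^k` (letters of `A j` have distinct heights — pad them to
words), so there are `≤ k` of them.  (iii) Greediness is antitone in the box, so `a` lies in the shadow of
the box `gr A f w` of greedy letters.  (iv) This box only depends on the set `code A w` of strict height
comparisons between letters; every direction is a positive multiple of a chart direction `(σ, l)`,
`σ ∈ {1, -1, 0}`, along a chart each comparison is the sign of an affine function of `l`, hence monotone,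
so `≤ P + 1` codes occur per chart (`P ≤ m t²` comparisons).  Summing the hypothesis over the
`≤ 3 (m t² + 1) ≤ (kmt+2)^4` boxes concludes (`k = 0`: all columns vanish, the shadow is empty).  Helpers
live in the sub-namespace `AlphabetReduction` (sibling stub files define the same objects). -/

noncomputable section

open scoped BigOperators Classical

-- Sub = Summit single-conjunct layout: the duplicated namespace component is mandated by the tree.
set_option linter.dupNamespace false

namespace Summit.ValiantsHypothesis.ValiantsHypothesis.Theorems.NewtonUnitEquationsDissociatedUniform

namespace AlphabetReduction

variable {k m : ℕ}

/-- Height `⟪w, e⟫` of an exponent `e` in direction `w`. [folklore] -/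
def height (w : Fin 2 → ℝ) (e : Fin 2 →₀ ℕ) : ℝ := ∑ i, w i * ((e i : ℕ) : ℝ)

/-- Khatri–Rao column of a word `a`: `(col f a) i = ∏ j, coeff (a j) (f i j)`. [folklore] -/
def col (f : Fin k → Fin m → MvPolynomial (Fin 2) ℂ) (a : Fin m → (Fin 2 →₀ ℕ)) : Fin k → ℂ :=
  fun i => ∏ j, (f i j).coeff (a j)

/-- Letter column of the letter `ℓ` in coordinate `j`: `(cvec f j ℓ) i = coeff ℓ (f i j)`. [folklore] -/
def cvec (f : Fin k → Fin m → MvPolynomial (Fin 2) ℂ) (j : Fin m) (ℓ : Fin 2 →₀ ℕ) : Fin k → ℂ :=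
  fun i => (f i j).coeff ℓ

/-- Greedy words in direction `w`: the column is not in the span of the columns of strictly higher
words. [folklore] -/
def greedy (A : Fin m → Finset (Fin 2 →₀ ℕ)) (f : Fin k → Fin m → MvPolynomial (Fin 2) ℂ)
    (w : Fin 2 → ℝ) : Set (Fin m → (Fin 2 →₀ ℕ)) :=
  {a | a ∈ Fintype.piFinset A ∧ col f a ∉ Submodule.span ℂ
    (col f '' {b | b ∈ Fintype.piFinset A ∧ height w (∑ j, a j) < height w (∑ j, b j)})}

/-- The greedy shadow: words greedy for some generic direction (heights separate words). [folklore] -/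
def shadow (A : Fin m → Finset (Fin 2 →₀ ℕ)) (f : Fin k → Fin m → MvPolynomial (Fin 2) ℂ) :
    Set (Fin m → (Fin 2 →₀ ℕ)) :=
  {a | a ∈ Fintype.piFinset A ∧ ∃ w : Fin 2 → ℝ,
    (∀ a ∈ Fintype.piFinset A, ∀ b ∈ Fintype.piFinset A,
      height w (∑ j, a j) = height w (∑ j, b j) → a = b) ∧ a ∈ greedy A f w}

/-- Greedy letters of `A j` in direction `w`: the letter column is not in the span of the letter columns
of strictly higher letters. [folklore] -/
def gr (A : Fin m → Finset (Fin 2 →₀ ℕ)) (f : Fin k → Fin m → MvPolynomial (Fin 2) ℂ)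
    (w : Fin 2 → ℝ) (j : Fin m) : Finset (Fin 2 →₀ ℕ) :=
  (A j).filter fun ℓ => cvec f j ℓ ∉ Submodule.span ℂ
    (cvec f j '' {ℓ' | ℓ' ∈ A j ∧ height w ℓ < height w ℓ'})

/-- Heights are additive. [folklore] -/
theorem height_add (w : Fin 2 → ℝ) (e e' : Fin 2 →₀ ℕ) :
    height w (e + e') = height w e + height w e' := by
  simp only [height, Finsupp.add_apply, Nat.cast_add, mul_add, Finset.sum_add_distrib]

/-- Height of a padded word. [folklore] -/
theorem height_update (w : Fin 2 → ℝ) (a : Fin m → (Fin 2 →₀ ℕ)) (j : Fin m) (ℓ : Fin 2 →₀ ℕ) :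
    height w (∑ i, Function.update a j ℓ i) = height w (∑ i, a i) + height w ℓ - height w (a j) := by
  have h : ∑ i, Function.update a j ℓ i + a j = ∑ i, a i + ℓ := by
    rw [Finset.sum_update_of_mem (Finset.mem_univ j),
      Finset.sum_eq_add_sum_sdiff_singleton_of_mem (Finset.mem_univ j) a]
    abel
  have h' := congrArg (height w) h
  rw [height_add, height_add] at h'
  linarith

/-- Padded words stay in the box. [folklore] -/
theorem update_mem_piFinset {A : Fin m → Finset (Fin 2 →₀ ℕ)} {a : Fin m → (Fin 2 →₀ ℕ)}
    (ha : a ∈ Fintype.piFinset A) {j : Fin m} {ℓ : Fin 2 →₀ ℕ} (hℓ : ℓ ∈ A j) :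
    Function.update a j ℓ ∈ Fintype.piFinset A := by
  refine Fintype.mem_piFinset.2 fun i => ?_
  rcases eq_or_ne i j with rfl | hne
  · rwa [Function.update_self]
  · simpa only [Function.update_of_ne hne] using Fintype.mem_piFinset.1 ha i

/-- (0) For a generic direction and a nonempty box, letters have distinct heights. [folklore] -/
theorem injOn_height {A : Fin m → Finset (Fin 2 →₀ ℕ)} {w : Fin 2 → ℝ}
    (hw : ∀ a ∈ Fintype.piFinset A, ∀ b ∈ Fintype.piFinset A,
      height w (∑ j, a j) = height w (∑ j, b j) → a = b)
    {a : Fin m → (Fin 2 →₀ ℕ)} (ha : a ∈ Fintype.piFinset A) (j : Fin m) :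
    Set.InjOn (height w) (A j : Set (Fin 2 →₀ ℕ)) := by
  intro ℓ hℓ ℓ' hℓ' h
  have := hw _ (update_mem_piFinset ha hℓ) _ (update_mem_piFinset ha hℓ')
    (by rw [height_update, height_update, h])
  simpa using congrFun this j

/-- Column of a padded word: letter column times the product of the other coordinates. [folklore] -/
theorem col_update (f : Fin k → Fin m → MvPolynomial (Fin 2) ℂ) (a : Fin m → (Fin 2 →₀ ℕ))
    (j : Fin m) (ℓ : Fin 2 →₀ ℕ) :
    col f (Function.update a j ℓ)
      = cvec f j ℓ * fun i => ∏ j' ∈ Finset.univ.erase j, (f i j').coeff (a j') := by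
  funext i
  simp only [col, cvec, Pi.mul_apply]
  rw [← Finset.mul_prod_erase _ _ (Finset.mem_univ j), Function.update_self]
  congr 1
  exact Finset.prod_congr rfl fun j' hj' => by rw [Function.update_of_ne (Finset.ne_of_mem_erase hj')]

/-- (i) The letter lemma: every letter of a greedy word is a greedy letter. [folklore] -/
theorem apply_mem_gr {A : Fin m → Finset (Fin 2 →₀ ℕ)} {f : Fin k → Fin m → MvPolynomial (Fin 2) ℂ}
    {w : Fin 2 → ℝ} {a : Fin m → (Fin 2 →₀ ℕ)} (ha : a ∈ greedy A f w) (j : Fin m) :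
    a j ∈ gr A f w j := by
  refine Finset.mem_filter.2 ⟨Fintype.mem_piFinset.1 ha.1 j, fun hmem => ha.2 ?_⟩
  have key := Submodule.apply_mem_span_image_of_mem_span
    (LinearMap.mulRight ℂ fun i => ∏ j' ∈ Finset.univ.erase j, (f i j').coeff (a j')) hmem
  rw [LinearMap.mulRight_apply, ← col_update, Function.update_eq_self, ← Set.image_comp] at key
  refine Submodule.span_mono ?_ key
  rintro _ ⟨ℓ', ⟨hℓ'A, hlt⟩, rfl⟩
  refine ⟨Function.update a j ℓ', ⟨update_mem_piFinset ha.1 hℓ'A, ?_⟩, ?_⟩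
  · rw [height_update]
    linarith
  · simp only [Function.comp_apply, LinearMap.mulRight_apply, col_update]

/-- (ii) A lex-first family (each vector outside the span of the strictly later ones, for an injective
valuation) is linearly independent, hence has at most `finrank` members. [folklore] -/
theorem card_filter_notMem_span_le {α V : Type*} [AddCommGroup V] [Module ℂ V] [Module.Finite ℂ V]
    (S : Finset α) (h : α → ℝ) (v : α → V) (hinj : Set.InjOn h (S : Set α)) :
    (S.filter fun x => v x ∉ Submodule.span ℂ (v '' {y | y ∈ S ∧ h x < h y})).card
      ≤ Module.finrank ℂ V := by
  set G := S.filter fun x => v x ∉ Submodule.span ℂ (v '' {y | y ∈ S ∧ h x < h y})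
  suffices key : ∀ T : Finset α, T ⊆ G → LinearIndepOn ℂ v (T : Set α) by
    simpa using (key G subset_rfl).linearIndependent.fintype_card_le_finrank
  intro T
  refine Finset.induction_on_min_value h T (fun _ => ?_) fun b s hb hmin ih hsub => ?_
  · rw [Finset.coe_empty]
    exact linearIndepOn_empty ℂ v
  have hbG : b ∈ G := hsub (Finset.mem_insert_self b s)
  have hsG : s ⊆ G := fun x hx => hsub (Finset.mem_insert_of_mem hx)
  rw [Finset.coe_insert]
  refine (ih hsG).insert fun hmem => (Finset.mem_filter.1 hbG).2 (Submodule.span_mono ?_ hmem)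
  refine Set.image_mono fun x hx => ⟨(Finset.mem_filter.1 (hsG hx)).1,
    lt_of_le_of_ne (hmin x hx) fun heq => hb ?_⟩
  rwa [hinj (Finset.mem_filter.1 hbG).1 (Finset.mem_filter.1 (hsG hx)).1 heq]

/-- (iii) A greedy word for a generic direction is in the shadow of the box of greedy letters. [folklore] -/
theorem mem_shadow_gr {A : Fin m → Finset (Fin 2 →₀ ℕ)} {f : Fin k → Fin m → MvPolynomial (Fin 2) ℂ}
    {w : Fin 2 → ℝ} (hw : ∀ a ∈ Fintype.piFinset A, ∀ b ∈ Fintype.piFinset A,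
      height w (∑ j, a j) = height w (∑ j, b j) → a = b)
    {a : Fin m → (Fin 2 →₀ ℕ)} (ha : a ∈ greedy A f w) : a ∈ shadow (gr A f w) f := by
  have hsub : Fintype.piFinset (gr A f w) ⊆ Fintype.piFinset A :=
    Fintype.piFinset_subset _ _ fun j => Finset.filter_subset _ _
  have hmem : a ∈ Fintype.piFinset (gr A f w) := Fintype.mem_piFinset.2 (apply_mem_gr ha)
  refine ⟨hmem, w, fun b hb c hc h => hw b (hsub hb) c (hsub hc) h, hmem, fun h =>
    ha.2 (Submodule.span_mono (Set.image_mono ?_) h)⟩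
  exact fun b hb => ⟨hsub hb.1, hb.2⟩

/-- Index type of letter comparisons `(j, ℓ, ℓ')`. [folklore] -/
abbrev Pair (m : ℕ) := Σ _ : Fin m, (Fin 2 →₀ ℕ) × (Fin 2 →₀ ℕ)

/-- All comparisons `(j, ℓ, ℓ')` with `ℓ, ℓ' ∈ A j`. [folklore] -/
def pairs (A : Fin m → Finset (Fin 2 →₀ ℕ)) : Finset (Pair m) :=
  Finset.univ.sigma fun j => A j ×ˢ A j

/-- The code of a direction: the comparisons that hold strictly. [folklore] -/
def code (A : Fin m → Finset (Fin 2 →₀ ℕ)) (w : Fin 2 → ℝ) : Finset (Pair m) :=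
  (pairs A).filter fun p => height w p.2.1 < height w p.2.2

/-- The codes realised along the three charts `(σ, l)`, `σ ∈ {1, -1, 0}`, `l ∈ ℝ`. [folklore] -/
def codes (A : Fin m → Finset (Fin 2 →₀ ℕ)) : Set (Finset (Pair m)) :=
  ⋃ σ ∈ ({1, -1, 0} : Finset ℝ), Set.range fun l : ℝ => (pairs A).filter fun p =>
    0 < σ * (((p.2.2 0 : ℕ) : ℝ) - ((p.2.1 0 : ℕ) : ℝ)) + l * (((p.2.2 1 : ℕ) : ℝ) - ((p.2.1 1 : ℕ) : ℝ))

/-- Greedy letters read off a code `S`. [folklore] -/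
def grS (A : Fin m → Finset (Fin 2 →₀ ℕ)) (f : Fin k → Fin m → MvPolynomial (Fin 2) ℂ)
    (S : Finset (Pair m)) (j : Fin m) : Finset (Fin 2 →₀ ℕ) :=
  (A j).filter fun ℓ => cvec f j ℓ ∉ Submodule.span ℂ
    (cvec f j '' {ℓ' | ℓ' ∈ A j ∧ (⟨j, (ℓ, ℓ')⟩ : Pair m) ∈ S})

/-- The admissible box read off a code (guarded so that it always has `≤ k` letters). [folklore] -/
def boxOf (k : ℕ) (A : Fin m → Finset (Fin 2 →₀ ℕ)) (f : Fin k → Fin m → MvPolynomial (Fin 2) ℂ)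
    (S : Finset (Pair m)) (j : Fin m) : Finset (Fin 2 →₀ ℕ) :=
  if (grS A f S j).card ≤ k then grS A f S j else ∅

/-- Boxes read off codes are admissible sub-boxes. [folklore] -/
theorem boxOf_subset_and_card (A : Fin m → Finset (Fin 2 →₀ ℕ))
    (f : Fin k → Fin m → MvPolynomial (Fin 2) ℂ) (S : Finset (Pair m)) (j : Fin m) :
    boxOf k A f S j ⊆ A j ∧ (boxOf k A f S j).card ≤ k := by
  unfold boxOf
  split_ifs with h
  exacts [⟨Finset.filter_subset _ _, h⟩, ⟨Finset.empty_subset _, by simp⟩]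

/-- The box read off the code of a direction separating letters is the greedy-letter box. [folklore] -/
theorem boxOf_code {A : Fin m → Finset (Fin 2 →₀ ℕ)} (f : Fin k → Fin m → MvPolynomial (Fin 2) ℂ)
    {w : Fin 2 → ℝ} (hinj : ∀ j, Set.InjOn (height w) (A j : Set (Fin 2 →₀ ℕ))) :
    boxOf k A f (code A w) = gr A f w := by
  funext j
  have h1 : grS A f (code A w) j = gr A f w j := by
    refine Finset.filter_congr fun ℓ hℓ => ?_
    have : {ℓ' | ℓ' ∈ A j ∧ (⟨j, (ℓ, ℓ')⟩ : Pair m) ∈ code A w}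
        = {ℓ' | ℓ' ∈ A j ∧ height w ℓ < height w ℓ'} :=
      Set.ext fun ℓ' => and_congr_right fun hℓ' => by simp [code, pairs, hℓ, hℓ']
    rw [this]
  have h2 : (gr A f w j).card ≤ k := by
    simpa [gr] using card_filter_notMem_span_le (A j) (height w) (cvec f j) (hinj j)
  rw [boxOf, h1, if_pos h2]

/-- Along a line, the positivity pattern of finitely many affine functions `l ↦ α p + l * β p` takes at
most `#P + 1` values: each coordinate is monotone in `l`, so the potential `τ` is strictly monotone along
pattern changes. [folklore] -/
theorem ncard_range_filter_le {ι : Type*} (P : Finset ι) (α β : ι → ℝ) :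
    (Set.range fun l : ℝ => P.filter fun p => 0 < α p + l * β p).ncard ≤ P.card + 1 := by
  set F : ℝ → Finset ι := fun l => P.filter fun p => 0 < α p + l * β p
  set τ : Finset ι → ℕ := fun T =>
    (T.filter fun p => 0 ≤ β p).card + ((P \ T).filter fun p => β p < 0).card
  have hFm : ∀ l p, p ∈ F l ↔ p ∈ P ∧ 0 < α p + l * β p := fun l p => Finset.mem_filter
  have mono1 : ∀ {l l'}, l ≤ l' →
      (F l).filter (fun p => 0 ≤ β p) ⊆ (F l').filter fun p => 0 ≤ β p := by
    intro l l' hll p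
    simp only [Finset.mem_filter, hFm]
    rintro ⟨⟨hp, h1⟩, h2⟩
    exact ⟨⟨hp, by nlinarith [mul_le_mul_of_nonneg_right hll h2]⟩, h2⟩
  have mono2 : ∀ {l l'}, l ≤ l' →
      (P \ F l).filter (fun p => β p < 0) ⊆ (P \ F l').filter fun p => β p < 0 := by
    intro l l' hll p
    simp only [Finset.mem_filter, Finset.mem_sdiff, hFm, not_and, not_lt]
    rintro ⟨⟨hp, h1⟩, h2⟩
    exact ⟨⟨hp, fun _ => by nlinarith [h1 hp, mul_le_mul_of_nonpos_right hll h2.le]⟩, h2⟩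
  have key : ∀ {l l'}, l ≤ l' → F l ≠ F l' → τ (F l) < τ (F l') := by
    intro l l' hll hne
    obtain ⟨p, hp⟩ : ∃ p, ¬(p ∈ F l ↔ p ∈ F l') := not_forall.1 fun hcon => hne (Finset.ext hcon)
    rw [hFm, hFm] at hp
    rcases le_or_gt 0 (β p) with hβ | hβ
    · have hle : α p + l * β p ≤ α p + l' * β p := by nlinarith [mul_le_mul_of_nonneg_right hll hβ]
      have hR : p ∈ P ∧ 0 < α p + l' * β p := by
        by_contra hR
        exact hp ⟨fun hL => ⟨hL.1, hL.2.trans_le hle⟩, fun hR' => absurd hR' hR⟩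
      have hL : ¬(0 < α p + l * β p) := fun hL => hp ⟨fun _ => hR, fun _ => ⟨hR.1, hL⟩⟩
      refine add_lt_add_of_lt_of_le (Finset.card_lt_card ⟨mono1 hll, fun hsub => hL ?_⟩)
        (Finset.card_le_card (mono2 hll))
      exact ((hFm _ _).1 (Finset.mem_filter.1 (hsub (Finset.mem_filter.2 ⟨(hFm _ _).2 hR, hβ⟩))).1).2
    · have hle : α p + l' * β p ≤ α p + l * β p := by
        nlinarith [mul_le_mul_of_nonpos_right hll hβ.le]
      have hL : p ∈ P ∧ 0 < α p + l * β p := by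
        by_contra hL
        exact hp ⟨fun hL' => absurd hL' hL, fun hR => ⟨hR.1, hR.2.trans_le hle⟩⟩
      have hR : ¬(0 < α p + l' * β p) := fun hR => hp ⟨fun _ => ⟨hL.1, hR⟩, fun _ => hL⟩
      refine add_lt_add_of_le_of_lt (Finset.card_le_card (mono1 hll))
        (Finset.card_lt_card ⟨mono2 hll, fun hsub => ?_⟩)
      have hmem : p ∈ (P \ F l').filter fun p => β p < 0 :=
        Finset.mem_filter.2 ⟨Finset.mem_sdiff.2 ⟨hL.1, fun h' => hR ((hFm _ _).1 h').2⟩, hβ⟩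
      exact (Finset.mem_sdiff.1 (Finset.mem_filter.1 (hsub hmem)).1).2 ((hFm _ _).2 hL)
  have hbound : ∀ l, τ (F l) < P.card + 1 := by
    intro l
    rw [Nat.lt_succ_iff, ← Finset.card_filter_add_card_filter_not (s := P) fun p => 0 ≤ β p]
    refine add_le_add (Finset.card_le_card (Finset.filter_subset_filter _ (Finset.filter_subset _ _)))
      (Finset.card_le_card fun p hp => ?_)
    simp only [Finset.mem_filter, Finset.mem_sdiff, not_le] at hp ⊢
    exact ⟨hp.1.1, hp.2⟩
  have hinj : Set.InjOn τ (Set.range F) := by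
    rintro _ ⟨l, rfl⟩ _ ⟨l', rfl⟩ hτeq
    by_contra hne
    rcases le_total l l' with hll | hll
    · exact (key hll hne).ne hτeq
    · exact (key hll (Ne.symm hne)).ne hτeq.symm
  calc (Set.range F).ncard = (τ '' Set.range F).ncard := hinj.ncard_image.symm
    _ ≤ ((Finset.range (P.card + 1) : Finset ℕ) : Set ℕ).ncard := by
        refine Set.ncard_le_ncard ?_ (Finset.finite_toSet _)
        rintro _ ⟨_, ⟨l, rfl⟩, rfl⟩
        simpa using hbound l
    _ = P.card + 1 := by rw [Set.ncard_coe_finset, Finset.card_range]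

/-- Every direction is a positive multiple of a chart direction `(σ, l)`, `σ ∈ {1, -1, 0}`. [folklore] -/
theorem exists_chart (w : Fin 2 → ℝ) : ∃ σ ∈ ({1, -1, 0} : Finset ℝ), ∃ c : ℝ, 0 < c ∧ ∃ l : ℝ,
    ∀ e : Fin 2 →₀ ℕ, height w e = c * (σ * (e 0 : ℝ) + l * (e 1 : ℝ)) := by
  simp only [height, Fin.sum_univ_two, Fin.isValue]
  rcases lt_trichotomy 0 (w 0) with h | h | h
  · refine ⟨1, by simp, w 0, h, w 1 / w 0, fun e => ?_⟩
    field_simp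
  · refine ⟨0, by simp, 1, one_pos, w 1, fun e => ?_⟩
    rw [← h]
    ring
  · refine ⟨-1, by simp, -w 0, by linarith, w 1 / (-w 0), fun e => ?_⟩
    have h0 : w 0 ≠ 0 := h.ne
    field_simp
    ring

/-- The code of every direction is realised on a chart. [folklore] -/
theorem code_mem_codes (A : Fin m → Finset (Fin 2 →₀ ℕ)) (w : Fin 2 → ℝ) : code A w ∈ codes A := by
  obtain ⟨σ, hσ, c, hc, l, h⟩ := exists_chart w
  simp only [codes, Set.mem_iUnion, Set.mem_range]
  refine ⟨σ, hσ, l, (Finset.filter_congr fun p _ => ?_).symm⟩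
  rw [h, h, mul_lt_mul_iff_right₀ hc]
  constructor <;> intro <;> linarith

/-- The realised codes are finitely many. [folklore] -/
theorem codes_finite (A : Fin m → Finset (Fin 2 →₀ ℕ)) : (codes A).Finite :=
  (pairs A).powerset.finite_toSet.subset fun S hS => by
    simp only [codes, Set.mem_iUnion, Set.mem_range] at hS
    obtain ⟨σ, -, l, rfl⟩ := hS
    exact Finset.mem_coe.2 (Finset.mem_powerset.2 (Finset.filter_subset _ _))

/-- At most `3 (m t² + 1)` codes are realised. [folklore] -/
theorem ncard_codes_le {t : ℕ} (A : Fin m → Finset (Fin 2 →₀ ℕ)) (hA : ∀ j, (A j).card ≤ t) :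
    (codes A).ncard ≤ 3 * (m * t ^ 2 + 1) := by
  have hP : (pairs A).card ≤ m * t ^ 2 := by
    rw [pairs, Finset.card_sigma]
    calc ∑ j, (A j ×ˢ A j).card ≤ ∑ _j : Fin m, t ^ 2 := Finset.sum_le_sum fun j _ => by
            rw [Finset.card_product, sq]
            exact Nat.mul_le_mul (hA j) (hA j)
      _ = m * t ^ 2 := by simp
  refine (Finset.set_ncard_biUnion_le _ _).trans ((Finset.sum_le_sum fun σ _ =>
    (ncard_range_filter_le _ _ _).trans (Nat.succ_le_succ hP)).trans ?_)
  rw [Finset.sum_const, smul_eq_mul]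
  exact Nat.mul_le_mul_right _ Finset.card_le_three

/-- The shadow is covered by the shadows of the boxes read off the realised codes. [folklore] -/
theorem shadow_subset (A : Fin m → Finset (Fin 2 →₀ ℕ)) (f : Fin k → Fin m → MvPolynomial (Fin 2) ℂ) :
    shadow A f ⊆ ⋃ S ∈ codes A, shadow (boxOf k A f S) f := by
  rintro a ⟨haA, w, hw, hgr⟩
  refine Set.mem_biUnion (code_mem_codes A w) ?_
  rw [boxOf_code f (injOn_height hw haA)]
  exact mem_shadow_gr hw hgr

/-- **Alphabet reduction** (readable form): if every sub-box with `≤ k` letters per coordinate has a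
shadow of size `≤ N`, a frame with `≤ t` letters per coordinate has a shadow of size `≤ (kmt+2)^4 N`.
[folklore] -/
theorem ncard_shadow_le (k m t : ℕ) (A : Fin m → Finset (Fin 2 →₀ ℕ))
    (f : Fin k → Fin m → MvPolynomial (Fin 2) ℂ) (hA : ∀ j, (A j).card ≤ t) (N : ℕ)
    (hN : ∀ B : Fin m → Finset (Fin 2 →₀ ℕ), (∀ j, B j ⊆ A j) → (∀ j, (B j).card ≤ k) →
      (shadow B f).ncard ≤ N) :
    (shadow A f).ncard ≤ (k * m * t + 2) ^ 4 * N := by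
  rcases Nat.eq_zero_or_pos k with rfl | hk
  · have : shadow A f = ∅ := Set.eq_empty_of_forall_notMem fun a ha => by
      obtain ⟨-, w, -, -, h⟩ := ha
      exact h (by rw [Subsingleton.elim (col f a) 0]; exact Submodule.zero_mem _)
    simp [this]
  have hfin := codes_finite A
  calc (shadow A f).ncard ≤ (⋃ S ∈ hfin.toFinset, shadow (boxOf k A f S) f).ncard := by
        refine Set.ncard_le_ncard (fun a ha => ?_) (Set.Finite.biUnion (Finset.finite_toSet _)
          fun S _ => (Fintype.piFinset (boxOf k A f S)).finite_toSet.subset fun _ ha => ha.1)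
        have := shadow_subset A f ha
        simp only [Set.mem_iUnion, Set.Finite.mem_toFinset] at this ⊢
        exact this
    _ ≤ ∑ S ∈ hfin.toFinset, (shadow (boxOf k A f S) f).ncard := Finset.set_ncard_biUnion_le _ _
    _ ≤ ∑ _S ∈ hfin.toFinset, N :=
        Finset.sum_le_sum fun S _ => hN _ (fun j => (boxOf_subset_and_card A f S j).1)
          fun j => (boxOf_subset_and_card A f S j).2
    _ = (codes A).ncard * N := by
        rw [Finset.sum_const, smul_eq_mul, Set.ncard_eq_toFinset_card _ hfin]
    _ ≤ 3 * (m * t ^ 2 + 1) * N := Nat.mul_le_mul_right _ (ncard_codes_le A hA)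
    _ ≤ (k * m * t + 2) ^ 4 * N := by
        refine Nat.mul_le_mul_right _ ?_
        have h1 : m * t ^ 2 ≤ (k * m * t) ^ 2 := by
          nlinarith [Nat.mul_le_mul (Nat.mul_le_mul_right (t ^ 2) (Nat.le_mul_self m))
            (Nat.mul_le_mul hk hk)]
        nlinarith [h1, Nat.zero_le (k * m * t)]

end AlphabetReduction

/-- **Stub C — alphabet reduction** (registered signature of the skeleton of crux
`NewtonUnitEquations.DissociatedUniform`, line `greedy-basis-shadow`): if every sub-box of `A` with `≤ k`
letters per coordinate has a greedy shadow of size `≤ N`, then the frame `A` (with `≤ t` letters per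
coordinate) has a greedy shadow of size `≤ (k*m*t+2)^4 * N`.  The dissociation hypothesis is not needed.
[folklore] -/
theorem stub_alphabetReduction :
    ∃ c : ℕ, ∀ (k m t : ℕ) (A : Fin m → Finset (Fin 2 →₀ ℕ)) (f : Fin k → Fin m → MvPolynomial (Fin 2) ℂ),
      (∀ j, (A j).card ≤ t) →
      (∀ a b : Fin m → (Fin 2 →₀ ℕ), (∀ j, a j ∈ A j) → (∀ j, b j ∈ A j) → ∑ j, a j = ∑ j, b j → a = b) →
      ∀ N : ℕ,
        (∀ B : Fin m → Finset (Fin 2 →₀ ℕ), (∀ j, B j ⊆ A j) → (∀ j, (B j).card ≤ k) →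
          {a : Fin m → (Fin 2 →₀ ℕ) | a ∈ Fintype.piFinset B ∧ ∃ w : Fin 2 → ℝ,
            (∀ a ∈ Fintype.piFinset B, ∀ b ∈ Fintype.piFinset B,
              (∑ i, w i * (((∑ j, a j) i : ℕ) : ℝ)) = (∑ i, w i * (((∑ j, b j) i : ℕ) : ℝ)) → a = b) ∧
            a ∈ {a : Fin m → (Fin 2 →₀ ℕ) | a ∈ Fintype.piFinset B ∧
                (fun i => ∏ j, (f i j).coeff (a j)) ∉ Submodule.span ℂ
                  ((fun b : Fin m → (Fin 2 →₀ ℕ) => fun i => ∏ j, (f i j).coeff (b j)) ''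
                    {b | b ∈ Fintype.piFinset B ∧
                      (∑ i, w i * (((∑ j, a j) i : ℕ) : ℝ)) < ∑ i, w i * (((∑ j, b j) i : ℕ) : ℝ)})}}.ncard ≤ N) →
        {a : Fin m → (Fin 2 →₀ ℕ) | a ∈ Fintype.piFinset A ∧ ∃ w : Fin 2 → ℝ,
          (∀ a ∈ Fintype.piFinset A, ∀ b ∈ Fintype.piFinset A,
            (∑ i, w i * (((∑ j, a j) i : ℕ) : ℝ)) = (∑ i, w i * (((∑ j, b j) i : ℕ) : ℝ)) → a = b) ∧
          a ∈ {a : Fin m → (Fin 2 →₀ ℕ) | a ∈ Fintype.piFinset A ∧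
              (fun i => ∏ j, (f i j).coeff (a j)) ∉ Submodule.span ℂ
                ((fun b : Fin m → (Fin 2 →₀ ℕ) => fun i => ∏ j, (f i j).coeff (b j)) ''
                  {b | b ∈ Fintype.piFinset A ∧
                    (∑ i, w i * (((∑ j, a j) i : ℕ) : ℝ)) < ∑ i, w i * (((∑ j, b j) i : ℕ) : ℝ)})}}.ncard ≤ (k * m * t + 2) ^ c * N :=
  ⟨4, fun k m t A f hA _ N hN => AlphabetReduction.ncard_shadow_le k m t A f hA N hN⟩

end Summit.ValiantsHypothesis.ValiantsHypothesis.Theorems.NewtonUnitEquationsDissociatedUniform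

end
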